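import Summits.ValiantsHypothesis.ValiantsHypothesis.Theorems.BarrierLeverChainCertificatesSufficeForTropicalDet
import Summits.ValiantsHypothesis.ValiantsHypothesis.Theorems.BarrierLeverTropicalDetCertificateSuffices

/-!
# Route BarrierLever — glue item `ChainCertificatesDecideTheCore`
# (stmt-ValiantsHypothesis-19659), PROVED

Closing file (`--workitem stmt-ValiantsHypothesis-19659`; cell valiant-natproofs, rung V4, 𝒟-side;
prover seat valiant-natproofs-prover gen 7; item typed by planner p1-g10). The item is the glue
`ChainCertificateSuffices → ChainCertificatesExistOnIrreducibleLayouts →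
TransversalMinorsNonsingularOnIrreducibleLayouts` (items 19651 → 19658 → 19616): chain
certificates (in some coordinate order) on the R1/R2-IRREDUCIBLE injective layouts of dimension
`h + 1` give TT on that irreducible core.

**Proof.** Fix an irreducible injective layout `(u, w)` in dimension `h + 1` (the two irreducibility
hypotheses are passed through untouched). `ChainCertificatesExistOnIrreducibleLayouts` supplies a
coordinate order `γ` and a chain certificate read in that order; the pointwise glue
`ChainGlue.hasCert_of_chainCertificate_inOrder` (tree file
`…ChainCertificatesSufficeForTropicalDet`, item 19653: inject the side conditions along
`Finset.map γ`, apply `ChainCertificateSuffices` to the relabelled layout, pull the certificate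
back with `UTDSymm.hasCert_of_relabelRows/Cols`) gives a tropical-determinant certificate
`(D, π₀)` for `(u, w)`, and the POINTWISE kernel lemma of item 19315
(`…TropicalDet.tropicalDetCertificateSuffices`, val-np-p3) turns it into a complex matrix `H`
with the transversal layout matrix `(det H[ρ u_i, κ w_j])_{i,j}` nonsingular — the conclusion of
the core item for `(u, w)`.

WHAT THIS IS NOT: bookkeeping only; `ChainCertificatesExistOnIrreducibleLayouts` (19658) and the
core `TransversalMinorsNonsingularOnIrreducibleLayouts` (19616) are OPEN; nothing here on TT / TNS
/ item 19717 unconditionally, on crux stmt-ValiantsHypothesis-14610, or on `VP` versus `VNP`.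
-/

-- layout Summits/ValiantsHypothesis/ValiantsHypothesis forces the duplicated namespace component
set_option linter.dupNamespace false

namespace Summit.ValiantsHypothesis.ValiantsHypothesis.Theorems.BarrierLever.ChainGlue

open Finset
open Summit.ValiantsHypothesis.ValiantsHypothesis.Theses.BarrierLever
  (ChainCertificateSuffices ChainCertificatesExistOnIrreducibleLayouts
    TransversalMinorsNonsingularOnIrreducibleLayouts ChainCertificatesDecideTheCore)

/-- **Pointwise**: a tropical-determinant certificate for a layout (`UTDSymm.HasCert u w`) makes its
transversal layout matrix nonsingular for some `H` (item 19315, repackaged on `HasCert`). -/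
theorem transversalMinor_nonsingular_of_hasCert {h r : ℕ} (u w : Fin r → Finset (Fin h))
    (hc : UTDSymm.HasCert u w) :
    ∃ H : Matrix (Fin (h + h)) (Fin (h + h)) ℂ, (Matrix.of fun i j : Fin r =>
      (H.submatrix (fun a : Fin h => if a ∈ u i then Fin.castAdd h a else Fin.natAdd h a)
        (fun c : Fin h => if c ∈ w j then Fin.natAdd h c else Fin.castAdd h c)).det).det ≠ 0 := by
  obtain ⟨D, π₀, hπ⟩ := hc
  exact TropicalDet.tropicalDetCertificateSuffices h r u w D _ (fun _ _ => rfl) π₀ hπ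

/-- **Item stmt-ValiantsHypothesis-19659 `ChainCertificatesDecideTheCore`**, stated as the route
declaration itself: `ChainCertificateSuffices → ChainCertificatesExistOnIrreducibleLayouts →
TransversalMinorsNonsingularOnIrreducibleLayouts`. -/
theorem chainCertificatesDecideTheCore : ChainCertificatesDecideTheCore := by
  intro hS hE h r u w hu hw hR1 hR2
  obtain ⟨γ, e, f, π₀, S₀, hcert⟩ := hE h r u w hu hw hR1 hR2
  exact transversalMinor_nonsingular_of_hasCert u w
    (hasCert_of_chainCertificate_inOrder hS u w hu hw γ e f π₀ S₀ hcert)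

end Summit.ValiantsHypothesis.ValiantsHypothesis.Theorems.BarrierLever.ChainGlue
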